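import Summits.BirchSwinnertonDyer.BirchSwinnertonDyer.Theorems.ThetaPartnerAtTwoSignedTransportAtTwoResidualNaturality
import Summits.BirchSwinnertonDyer.BirchSwinnertonDyer.Theorems.ThetaPartnerAtTwoSignedTransportAtTwoResidualKummer
import Summits.BirchSwinnertonDyer.BirchSwinnertonDyer.Theorems.KatoDescentPotSupersingularFineSelmerLeSignedSelmerTools
import Literature.NumberTheory.EllipticCurves.Kobayashi2003.SignedSelmer
import Literature.NumberTheory.EllipticCurves.Rank1Residual.Predicates
import HarnessLib

/-!
# Transport of a Kummer condition along a homomorphism of local points, for the crux `SignedTransportAtTwo`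
# (stmt-BirchSwinnertonDyer-20333, route `ThetaPartnerAtTwo`, line `bridge` v13: the composition `sel2T_of_Ta`)
# (lead prover bsd-wall-tp2-p1 g4; `--supports stmt-BirchSwinnertonDyer-20333`; route-independent, closes nothing)

HONEST FRAMING. THEOREM ONLY (no definition); nothing about any curve is asserted; BSD is not proved by any of this.
No import of any route file.

WHAT. The registered local stub of line `bridge` v12 (`stub_sel2T`: the signed Kummer condition at `2` over `ℚ_∞` transports along
an equivariant `ẽ : W[2^∞][2] ≃ A[2^∞][2]`) is reduced in v13 to the existence of a `Gal(ℚ̄₂/ℚ₂)`-equivariant homomorphism of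
LOCAL POINTS `Ψ : W(ℚ̄₂) → A(ℚ̄₂)` carrying `W⁺(ℚ_{n,2})` into `A⁺(ℚ_{n,2})` and restricting to `ẽ` on the residual module
(`stub_sel2Ta`; Kim 2009 Prop. 2.11–2.12 in the currency of points). This file proves the abstract transport step, for any field `K`,
curves `W, A`, prime `p`, subgroup `H ≤ Γ_K`, `K`-embedding `ι : K̄ → K̄_E`, subgroups `B_W ≤ W(K̄_E)`, `B_A ≤ A(K̄_E)`:
`pushH1_mem_localKummerOverOfEmb_of_transport` — if `k_W(c) ∈ Kummer_H(B_W)` for a residual class `c`, `Ψ(B_W) ≤ B_A` and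
`Ψ ∘ ι_W = ι_A ∘ ẽ` on `W[p^∞][p]`, then `k_A(ẽ_* c) ∈ Kummer_H(B_A)` (a residual cocycle's witness `Q` — corrected by a coboundary —
goes to `Ψ Q`).

References: [BDKim2009] Prop. 2.11, 2.12; [Kobayashi2003] Def. 1.1; [GreenbergVatsal2000] §2 p. 28.
-/

set_option autoImplicit false
-- D-0017: single-problem summit, so `Summit.BirchSwinnertonDyer.BirchSwinnertonDyer.…` repeats a namespace BY DESIGN.
set_option linter.dupNamespace false

noncomputable section

open scoped Classical AddSubgroup

open WeierstrassCurve NumberField IsDedekindDomain Field Literature Literature.NumberTheory.EllipticCurves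
  Literature.NumberTheory.GaloisRepresentations Literature.NumberTheory.EllipticCurves.Kobayashi2003 ZpExtension
  Literature.NumberTheory.EllipticCurves.GreenbergVatsal2000 Literature.NumberTheory.EllipticCurves.Rank1Residual
  Summit.BirchSwinnertonDyer.BirchSwinnertonDyer.Theorems.FineSelmerLeSignedSelmer

namespace Summit.BirchSwinnertonDyer.BirchSwinnertonDyer.Theorems.SignedTransportAtTwo

universe u

section Transport

variable {K : Type u} [Field K] (W A : WeierstrassCurve K) (p : ℕ)
  (H : Subgroup (absoluteGaloisGroup K))
  {E : Type u} [Field E] [Algebra K E] (ι : AlgebraicClosure K →ₐ[K] AlgebraicClosure E)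

/-- **Transport of a Kummer condition along an equivariant homomorphism of local points.** Let
`e : W[p^∞][p] ≃+ A[p^∞][p]` be `Γ_K`-equivariant and `Ψ : W(K̄_E) →+ A(K̄_E)` a `Γ_E`-equivariant homomorphism with
`Ψ(B_W) ≤ B_A` and `Ψ ∘ ι_W = ι_A ∘ e` on `W[p^∞][p]`. If the Kummer image of a residual class `c ∈ H¹(H, W[p^∞][p])` lies in the
Kummer condition cut out by `B_W`, then the Kummer image of `e_* c` lies in the one cut out by `B_A`: a residual cocycle `φ₀` of `c`
has `ι_W φ₀(res τ) = τQ − Q` with `pᵏQ ∈ B_W` (cohomologous cocycles differ by `∂t`, absorbed into `Q`), and applying `Ψ` gives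
`ι_A e(φ₀(res τ)) = τ ΨQ − ΨQ`, `pᵏ ΨQ ∈ B_A`. (The formal-group step of Kim 2009 Prop. 2.11–2.12, abstracted.)
[cite: BDKim2009, Prop. 2.11 and Prop. 2.12] [cite: Kobayashi2003, Def. 1.1] -/
theorem pushH1_mem_localKummerOverOfEmb_of_transport
    (e : ↥((↥(W.geomPrimaryTorsion p))[(p : ℤ)]) ≃+ ↥((↥(A.geomPrimaryTorsion p))[(p : ℤ)]))
    (he : ∀ (σ : absoluteGaloisGroup K) (x : ↥((↥(W.geomPrimaryTorsion p))[(p : ℤ)])), e (σ • x) = σ • e x)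
    (Ψ : localPoints W E →+ localPoints A E)
    (hΨ : ∀ (τ : absoluteGaloisGroup E) (P : localPoints W E), Ψ (τ • P) = τ • Ψ P)
    (BW : AddSubgroup (localPoints W E)) (BA : AddSubgroup (localPoints A E)) (hB : BW.map Ψ ≤ BA)
    (hΨe : ∀ x : ↥((↥(W.geomPrimaryTorsion p))[(p : ℤ)]),
      Ψ (pointsMapOfEmb W ι ((x : W.geomPrimaryTorsion p) : W.geomPoints)) =
        pointsMapOfEmb A ι ((e x : A.geomPrimaryTorsion p) : A.geomPoints))
    (c : subgroupH1 H ↥((↥(W.geomPrimaryTorsion p))[(p : ℤ)]))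
    (hc : pushH1 H ((↥(W.geomPrimaryTorsion p))[(p : ℤ)]).subtype (subtype_torsionBy_smul W p) c ∈
      localKummerOverOfEmb W p H ι BW) :
    pushH1 H ((↥(A.geomPrimaryTorsion p))[(p : ℤ)]).subtype (subtype_torsionBy_smul A p)
        (pushH1 H e.toAddMonoidHom he c) ∈ localKummerOverOfEmb A p H ι BA := by
  obtain ⟨φ₀, rfl⟩ := oneCocycleClass_surjective _ c
  obtain ⟨φ, Q, k, hφ, hQ, hτ⟩ := hc
  -- the pushed residual cocycle represents `k(c)`; compare with `φ`
  have hk : pushH1 H ((↥(W.geomPrimaryTorsion p))[(p : ℤ)]).subtype (subtype_torsionBy_smul W p) (oneCocycleClass _ φ₀) =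
      oneCocycleClass (discreteTopRep H (W.geomPrimaryTorsion p))
        (contOneCocycles.pullback (ContinuousMonoidHom.id H)
          (resHomOfEquivariant (ContinuousMonoidHom.id H) ((↥(W.geomPrimaryTorsion p))[(p : ℤ)]).subtype
            (fun h x ↦ subtype_torsionBy_smul W p h x)) φ₀) :=
    map_oneCocycleClass _ _ _ φ₀
  have hdiff : oneCocycleClass _ (φ - contOneCocycles.pullback (ContinuousMonoidHom.id H)
      (resHomOfEquivariant (ContinuousMonoidHom.id H) ((↥(W.geomPrimaryTorsion p))[(p : ℤ)]).subtype
        (fun h x ↦ subtype_torsionBy_smul W p h x)) φ₀) = 0 := by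
    rw [oneCocycleClass_sub, hφ, hk, sub_self]
  obtain ⟨t, ht⟩ := (oneCocycleClass_eq_zero_iff _ _).mp hdiff
  -- corrected witness `Q' = Q − ι t`
  set Q' : localPoints W E := Q - pointsMapOfEmb W ι ((t : W.geomPrimaryTorsion p) : W.geomPoints) with hQ'
  have hφ₀τ : ∀ τ : localSubgroupOfEmb H ι,
      pointsMapOfEmb W ι (((φ₀.1 (resGalSubgroupOfEmb H ι τ) : ↥((↥(W.geomPrimaryTorsion p))[(p : ℤ)])) :
        W.geomPrimaryTorsion p) : W.geomPoints) = (τ : absoluteGaloisGroup E) • Q' - Q' := by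
    intro τ
    have h1 := hτ τ
    have h2 := ht (resGalSubgroupOfEmb H ι τ)
    have h3 : φ.1 (resGalSubgroupOfEmb H ι τ) =
        ((φ₀.1 (resGalSubgroupOfEmb H ι τ) : ↥((↥(W.geomPrimaryTorsion p))[(p : ℤ)])) : W.geomPrimaryTorsion p) +
          ((resGalOfEmb ι (τ : absoluteGaloisGroup E)) • t - t) := by
      have eq1 : (φ - contOneCocycles.pullback (ContinuousMonoidHom.id H)
          (resHomOfEquivariant (ContinuousMonoidHom.id H) ((↥(W.geomPrimaryTorsion p))[(p : ℤ)]).subtype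
            (fun h x ↦ subtype_torsionBy_smul W p h x)) φ₀).1 (resGalSubgroupOfEmb H ι τ) =
          φ.1 (resGalSubgroupOfEmb H ι τ) -
            ((φ₀.1 (resGalSubgroupOfEmb H ι τ) : ↥((↥(W.geomPrimaryTorsion p))[(p : ℤ)])) : W.geomPrimaryTorsion p) := rfl
      rw [eq1] at h2
      have h2' : φ.1 (resGalSubgroupOfEmb H ι τ) -
          ((φ₀.1 (resGalSubgroupOfEmb H ι τ) : ↥((↥(W.geomPrimaryTorsion p))[(p : ℤ)])) : W.geomPrimaryTorsion p) =
          (resGalOfEmb ι (τ : absoluteGaloisGroup E)) • t - t := h2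
      rw [sub_eq_iff_eq_add'] at h2'
      rw [h2']
    have h4 := congrArg (fun x : W.geomPrimaryTorsion p ↦ pointsMapOfEmb W ι (x : W.geomPoints)) h3
    simp only [AddSubgroup.coe_add, AddSubgroup.coe_sub, map_add, map_sub,
      Literature.NumberTheory.EllipticCurves.primaryComponent.coe_smul, pointsMapOfEmb_smul] at h4
    rw [h4] at h1
    rw [hQ', smul_sub]
    have h5 := h1
    calc pointsMapOfEmb W ι (((φ₀.1 (resGalSubgroupOfEmb H ι τ) : ↥((↥(W.geomPrimaryTorsion p))[(p : ℤ)])) :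
          W.geomPrimaryTorsion p) : W.geomPoints)
        = ((τ : absoluteGaloisGroup E) • Q - Q) -
            ((τ : absoluteGaloisGroup E) • pointsMapOfEmb W ι ((t : W.geomPrimaryTorsion p) : W.geomPoints) -
              pointsMapOfEmb W ι ((t : W.geomPrimaryTorsion p) : W.geomPoints)) := by rw [← h5]; abel
      _ = _ := by abel
  obtain ⟨kt, hkt⟩ := exists_pow_smul_geomPrimaryTorsion_eq_zero W (t : W.geomPrimaryTorsion p)
  have hQ'mem : (p ^ (k + kt)) • Q' ∈ BW := by
    have eq : (p ^ (k + kt)) • Q' = (p ^ kt) • ((p ^ k) • Q) := by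
      rw [hQ', smul_sub, pow_add, mul_comm, mul_nsmul, mul_nsmul, ← map_nsmul, ← map_nsmul]
      have : p ^ kt • ((t : W.geomPrimaryTorsion p) : W.geomPoints) = 0 := by
        rw [← AddSubmonoidClass.coe_nsmul, hkt, ZeroMemClass.coe_zero]
      rw [this, smul_zero, map_zero, sub_zero, smul_comm]
    rw [eq]
    exact AddSubgroup.nsmul_mem _ hQ _
  -- the pushed class of `e_* c` is represented by `e ∘ φ₀` pushed to `A[p^∞]`
  have hclass : pushH1 H ((↥(A.geomPrimaryTorsion p))[(p : ℤ)]).subtype (subtype_torsionBy_smul A p)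
      (pushH1 H e.toAddMonoidHom he (oneCocycleClass _ φ₀)) =
      oneCocycleClass (discreteTopRep H (A.geomPrimaryTorsion p))
        (contOneCocycles.pullback (ContinuousMonoidHom.id H)
          (resHomOfEquivariant (ContinuousMonoidHom.id H) ((↥(A.geomPrimaryTorsion p))[(p : ℤ)]).subtype
            (fun h x ↦ subtype_torsionBy_smul A p h x))
          (contOneCocycles.pullback (ContinuousMonoidHom.id H)
            (resHomOfEquivariant (ContinuousMonoidHom.id H) e.toAddMonoidHom (fun h x ↦ he h x)) φ₀)) := by
    have h1 : pushH1 H e.toAddMonoidHom he (oneCocycleClass _ φ₀) = oneCocycleClass _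
        (contOneCocycles.pullback (ContinuousMonoidHom.id H)
          (resHomOfEquivariant (ContinuousMonoidHom.id H) e.toAddMonoidHom (fun h x ↦ he h x)) φ₀) :=
      map_oneCocycleClass _ _ _ φ₀
    rw [h1]
    exact map_oneCocycleClass _ _ _ _
  rw [hclass]
  refine ⟨_, Ψ Q', k + kt, rfl, ?_, fun τ ↦ ?_⟩
  · rw [← map_nsmul]
    exact hB ⟨_, hQ'mem, rfl⟩
  · rw [contOneCocycles.pullback_apply, contOneCocycles.pullback_apply]
    change pointsMapOfEmb A ι ((e (φ₀.1 (resGalSubgroupOfEmb H ι τ)) : A.geomPrimaryTorsion p) : A.geomPoints) =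
      (τ : absoluteGaloisGroup E) • Ψ Q' - Ψ Q'
    rw [← hΨe, hφ₀τ τ, map_sub, hΨ]

end Transport

end Summit.BirchSwinnertonDyer.BirchSwinnertonDyer.Theorems.SignedTransportAtTwo

end
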